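import Summits.BirchSwinnertonDyer.BirchSwinnertonDyer.Theorems.EisensteinPrimesGoodLatticeBDPValueOfLambdaInequalityAnQ
import HarnessLib

/-!
# Crux 2 `GoodLatticeBDPValue` (stmt-BirchSwinnertonDyer-19032), line `halves` v22: the existence input H1
# WITHOUT Castella–Hsieh 2018 — stub 1's first PUB conjunct is redundant

Cell `bsd-eis`, width seat `bsd-line-x1-p1-w5` (gen 2); helper `--supports stmt-BirchSwinnertonDyer-19032`.

The registered line `halves` (skeleton v22, `Cruxes/GoodLatticeBDPValue/Lines/halves.lean`, sha256 873a80a3…) consumes the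
named fact `castellaHsieh2018_exists_isBDPLFunction` (Castella–Hsieh 2018 Def. 3.7 / Prop. 3.8: the BDP frame EXISTS at a good
odd prime split in `K`) at exactly ONE place: the existence input H1 `KellerYinHalves.GoodBDPExistsOnTree W p` of
`KellerYinHalves.thm308_of_halves`, through `goodBDPExistsOnTree_of_castellaHsieh2018` inside
`KellerYinHalves.thm308_of_cgls_of_muLambda hCH hC hdiv hval hml` (the single `hCH` occurrence of
`GoodLatticeBDPValueOfLambdaInequalityAnQ.goodLatticeBDPValue_of_pub_of_leTD_of_le_of_anQ`, p650549). But H1's own binders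
carry `Red W p`, (disc) `Odd d_K ∧ d_K ≠ −3`, (h1) `E(K)[p] = 0`, (Sel) `corank_{ℤ_p} Sel_{p^∞}(E/K) = 1`, the prime `v̄ ∋ p`,
`v̄ ≠ v`, `[Fact (κ.IsTopGenerator γ)]` and `[W.IsGloballyMinimal]` — precisely the antecedents of the line's THIRD PUB conjunct
`proofThm422_exists_isBDPLFunction_isTorsion_charIdeal_dvd` (CGLS 2022, proof of Thm. 4.2.2 first half), whose conclusion BEGINS
with the same frame `∃ Ω_K ≠ 0, Ω_p, L, IsBDPLFunction ι' v κ γ f Ω_K Ω_p L` (CGLS Thm. 2.1.1 = [CH18, Prop. 3.8] is quantified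
inside that fact). Hence:

* §1 `goodBDPExistsOnTree_of_cgls` — H1 from `proofThm422_…` + Carayol (the embedding datum `ι'` inducing `v` is built as in
  `goodBDPExistsOnTree_of_castellaHsieh2018`: `PadicAlgCl.nonempty_ringEquiv_complex` + `X11b.exists_datum_forall_mem_iff`;
  `N = N_E` by Carayol gives `p ∤ N` and (Heeg) for `N`, as in `goodLatticeDivOnTree_of_cgls`).
* §2 `thm308_of_cgls_of_muLambda_of_three` — `KellerYinHalves.thm308_of_cgls_of_muLambda` WITHOUT `hCH`:
  `h308 ⇐ {Carayol, CGLS proof-4.2.2, CGLS 5.1.3}` (PUB) `+ L-μλ`.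
* §3 `goodLatticeBDPValue_of_pub_of_leTD_of_le_of_anQ_of_cgls` — the crux BY NAME: the terminal consumer p650549 with the
  hypothesis `hCH` DELETED and every other binder byte-identical (body = its two lines, on §2).

RESHAPE OPTION for the LEAD (nothing registered by this seat): `stub_publishedFacts` 7 → 6 conjuncts (drop
`castellaHsieh2018_exists_isBDPLFunction`), the glue `goodLatticeBDPValue_of_namedFacts` calling §3 with the remaining six
components; line named facts 20 → 19. HONEST FRAMING: input bookkeeping — CONDITIONAL theorems on the named PUBLISHED facts +
the PRE inputs exactly as before minus one; closes no stub; no summit statement / BSD / IMC2 / Keller–Yin theorem is proved;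
0 sorry. presearch: Castella–Hsieh 2018 §4.1 [corpus: paper:arxiv-1505.08165 p0012 L6–8]: at weight 2 only (Heeg) is assumed
((can) is for `r > 1`), so the dropped fact was not stronger than print on (disc) — the gain is one input fewer, not a scope repair.

References: [CastellaGrossiLeeSkinner2022] proof of Thm. 4.2.2 (arXiv:2008.02571v2 TeX L2343–L2352), Thm. 4.1.2, Rem. 4.1.3,
Prop. 4.2.1, Thm. 2.1.1, Thm. 5.1.3; [CastellaHsieh2018] Def. 3.7 / Prop. 3.8, §4.1; [Carayol1986]; [KellerYin2024] Thm. 3.0.8.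
-/

set_option linter.dupNamespace false
set_option autoImplicit false

noncomputable section

open scoped Classical

open PowerSeries WeierstrassCurve NumberField IsDedekindDomain Field Rat.HeightOneSpectrum
  Literature.NumberTheory.EllipticCurves Literature.NumberTheory.EllipticCurves.ModularForms
  Literature.NumberTheory.QuadraticFields Literature.NumberTheory.EllipticCurves.Rank1Residual
  Literature.NumberTheory.EllipticCurves.Castella2018 Literature.NumberTheory.EllipticCurves.KellerYin2024
  Literature.NumberTheory.EllipticCurves.CastellaGrossiLeeSkinner2022 Literature.NumberTheory.GaloisRepresentations
  Literature.NumberTheory.EllipticCurves.GreenbergVatsal2000 Literature.NumberTheory.EllipticCurves.GreenbergSelmer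
  Literature.NumberTheory.EllipticCurves.IwasawaAlgebra Literature.NumberTheory.EllipticCurves.BCGKPST2020
  Literature.NumberTheory.EllipticCurves.Rubin1991 Literature.NumberTheory.EllipticCurves.DeShalit1987
  Literature.NumberTheory.EllipticCurves.Hida2010MuInvariant Literature.NumberTheory.IwasawaTheory
  Literature.NumberTheory.IwasawaTheory.Greenberg2016 Literature.NumberTheory.IwasawaTheory.Greenberg2006
open Summit.BirchSwinnertonDyer.Rank1Residual.X11b.Halves Summit.BirchSwinnertonDyer.Rank1Residual.X1.KellerYinHalves
  Summit.BirchSwinnertonDyer.Rank1Residual.X1.KellerYinMuLambdaSplit Summit.BirchSwinnertonDyer.BirchSwinnertonDyer.Theorems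
  Summit.BirchSwinnertonDyer.Rank1Residual.X1.KellerYinMuLambdaSplitDS
  Summit.BirchSwinnertonDyer.Rank1Residual.X1.KellerYinMuLambdaSplitDSFree
  Summit.BirchSwinnertonDyer.BirchSwinnertonDyer.Theorems.IwasawaTwoVariable
  Summit.BirchSwinnertonDyer.BirchSwinnertonDyer.Theorems.EisensteinPrimesMuLambda
  Summit.BirchSwinnertonDyer.BirchSwinnertonDyer.Theorems.GoodLatticeBDPValueHalves
  Summit.BirchSwinnertonDyer.BirchSwinnertonDyer.Theorems.GoodLatticeBDPValueOfImprimitive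


namespace Summit.BirchSwinnertonDyer.BirchSwinnertonDyer.Theorems.GoodLatticeBDPValueH1OfCGLS
open Summit.BirchSwinnertonDyer.BirchSwinnertonDyer.Theorems.GoodLatticeBDPValueOfOneInequality
  Summit.BirchSwinnertonDyer.BirchSwinnertonDyer.Theorems.GoodLatticeBDPValueOfLambdaIdentity
  Summit.BirchSwinnertonDyer.BirchSwinnertonDyer.Theorems.GoodLatticeBDPValueOfLambdaIdentityAnQ
  Summit.BirchSwinnertonDyer.BirchSwinnertonDyer.Theorems.GoodLatticeBDPValueOfLambdaInequality
  Summit.BirchSwinnertonDyer.BirchSwinnertonDyer.Theorems.GoodLatticeBDPValueOfLambdaInequalityAnQ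

/-! ## §1 H1 (the BDP frame exists, with an embedding datum inducing `v`) from CGLS's proof of Thm. 4.2.2 + Carayol -/

/-- **H1 from CGLS 2022 (proof of Thm. 4.2.2, first half) + Carayol — no Castella–Hsieh fact needed.** On the data of
`h308` the BDP frame EXISTS: `p ∈ v` (`‖ι(p)‖ = p⁻¹ < 1`), an embedding datum `ι'` inducing `v` exists
(`X11b.exists_datum_forall_mem_iff`), the level of `Dt.f` is `N_E` (Carayol, `hC`), so `p ∤ N` and (Heeg) for `N`; `p`
splits in `K`; H1's binders supply `Red`, (disc), (h1), (Sel), `v̄`; then the published fact `hdiv` gives CM periods and a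
frame `L` with `IsBDPLFunction ι' v κ γ Dt.f Ω_K Ω_p L` (its torsion/divisibility conjuncts are discarded here).
CONDITIONAL on the two named PUBLISHED facts.
[cite: CastellaGrossiLeeSkinner2022, proof of Thm. 4.2.2 (TeX L2343–L2352) with Thm. 2.1.1 (the frame `𝓛_E`)] [cite: Carayol1986] -/
theorem goodBDPExistsOnTree_of_cgls (hdiv : proofThm422_exists_isBDPLFunction_isTorsion_charIdeal_dvd)
    (hC : ∀ (N : ℕ) [NeZero N], IsNewformOf.level_eq_conductorNorm (N := N))
    (W : WeierstrassCurve ℚ) [W.IsElliptic] [W.IsGloballyMinimal] (p : ℕ) [Fact p.Prime] :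
    GoodBDPExistsOnTree W p := by
  intro hp hgood hred _han _hGL K _ _ hK hHN hHp hodd h3 hEK hSel ι v vbar hv hvbar hne κ hκ γ _ N _ Dt _H _ιC
    _P _hP
  have hp2 : p ≠ 2 := by omega
  -- `p ∈ v`
  have hpv : ((p : ℕ) : 𝓞 K) ∈ v.asIdeal := by
    rw [hv]
    have h1 : ((((p : ℕ) : 𝓞 K) : K)) = (p : K) := by push_cast; rfl
    rw [h1, map_natCast, Padic.norm_p]
    exact inv_lt_one_of_one_lt₀ (by exact_mod_cast (Fact.out : p.Prime).one_lt)
  -- an embedding datum inducing `v`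
  obtain ⟨ι₀⟩ := PadicAlgCl.nonempty_ringEquiv_complex p
  obtain ⟨ι', -, hι'⟩ := Summit.BirchSwinnertonDyer.Rank1Residual.X11b.exists_datum_forall_mem_iff p ι₀ hK hpv
  -- the level is the conductor: `p ∤ N` and (Heeg) for `N`
  have hN : N = W.conductorNorm ℤ := hC N Dt.isNewformOf
  have hpN : ¬ p ∣ N := by
    rw [hN, W.dvd_conductorNorm_iff_not_hasGoodReductionAtPrime p, not_not]
    exact hgood
  have hHeeg : SatisfiesHeegnerHypothesis N K := by rw [hN]; exact hHN
  have hsplit : ((Ideal.span {(p : ℤ)}).primesOver (𝓞 K)).ncard = 2 := hHp p Fact.out (dvd_refl p)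
  -- the published frame (torsion and divisibility conjuncts discarded)
  obtain ⟨ΩK, Ωp, L, hΩK, hL, -, -⟩ := hdiv ι' W K v vbar κ γ Dt.isNewformOf hp2 hpN hred hK hHeeg hsplit
    hodd h3 hEK hSel hι' hvbar hne hκ
  exact ⟨ι', hι', ΩK, Ωp, L, hΩK, hL⟩

/-! ## §2 `h308` from THREE published named facts and the one preprint statement -/

/-- **`h308` ⇐ {Carayol, CGLS proof of 4.2.2 (first half), CGLS Thm. 5.1.3} (PUBLISHED named facts) + L-μλ** —
`KellerYinHalves.thm308_of_cgls_of_muLambda` with the Castella–Hsieh hypothesis REMOVED: H1 by §1, L-div and L-val by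
`goodLatticeDivOnTree_of_cgls` / `goodBDPValueOnTree_of_cgls`. CONDITIONAL on the named inputs; nothing booked.
[cite: KellerYin2024, Thm. 3.0.8 (IMC2)] [cite: CastellaGrossiLeeSkinner2022, proof of Thm. 4.2.2, Thm. 5.1.3] [cite: Carayol1986] -/
theorem thm308_of_cgls_of_muLambda_of_three
    (hC : ∀ (N : ℕ) [NeZero N], IsNewformOf.level_eq_conductorNorm (N := N))
    (hdiv : proofThm422_exists_isBDPLFunction_isTorsion_charIdeal_dvd)
    (hval : thm513_exists_isBDPLFunction_valueAtOne)
    (hml : ∀ (W : WeierstrassCurve ℚ) [W.IsElliptic] [W.IsGloballyMinimal] (p : ℕ) [Fact p.Prime],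
      GoodLatticeMuLambdaOnTree W p) :
    thm308_imc2_bdpValue_goodLattice_OPEN :=
  thm308_of_halves (fun W _ _ p _ ↦ goodBDPExistsOnTree_of_cgls hdiv hC W p)
    (fun W _ _ p _ ↦ goodLatticeDivOnTree_of_cgls hdiv hC W p) hml
    (fun W _ _ p _ ↦ goodBDPValueOnTree_of_cgls hval hC W p)

/-! ## §3 The crux BY NAME without the Castella–Hsieh hypothesis -/

/-- **THE CRUX BY NAME — `Theses.EisensteinPrimes.GoodLatticeBDPValue` — from the PUBLISHED named facts of halves v22 MINUS
Castella–Hsieh 2018**: the terminal consumer `GoodLatticeBDPValueOfLambdaInequalityAnQ.goodLatticeBDPValue_of_pub_of_leTD_of_le_of_anQ`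
(p650549) with its first hypothesis `hCH : castellaHsieh2018_exists_isBDPLFunction` DELETED and every other binder
byte-identical; the body is its body with `thm308_of_cgls_of_muLambda` replaced by §2. CONDITIONAL (audit
`proof.conditional` on exactly the named hypotheses); closes nothing by itself; BSD is proved for no curve.
[claim: KellerYin2024, status: under-review]
[cite: KellerYin2024, Thm. 3.0.8 (IMC2) and proof (arXiv:2402.12781v2 TeX L1631–1640), Thm. 1.4.1, Thms. 2.2.1–2.2.3]
[cite: CastellaGrossiLeeSkinner2022, proof of Thm. 4.2.2, Thm. 4.1.2, Prop. 4.2.1, Thm. 5.1.3, Thm. 2.2.2, Prop. 1.2.5]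
[cite: Carayol1986] [cite: BleherEtAl2020, §3.3 Thm. 3.3.1] [cite: deShalit1987, II.6.4 Theorem (i)] [cite: Hida2010MuInvariant, Thm. I]
[cite: Greenberg2016Selmer, Prop. 4.1.1, Prop. 4.2.2] [cite: Greenberg2006, §5 A, Props. 3.2, 4.1, 4.2] [cite: NguyenQuangDo1984, Thm. 2.2] -/
theorem goodLatticeBDPValue_of_pub_of_leTD_of_le_of_anQ_of_cgls
    (hC : ∀ (N : ℕ) [NeZero N], IsNewformOf.level_eq_conductorNorm (N := N))
    (hdiv : proofThm422_exists_isBDPLFunction_isTorsion_charIdeal_dvd)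
    (hval : thm513_exists_isBDPLFunction_valueAtOne)
    (h331 : thm331_rubin_exists_katzMeasure₂_pseudoIso_span_eq)
    (hFE : thmII64_katzMeasure₂_functionalEquation) (hO1 : thmI_mu_katzBranch_reflect_eq_zero)
    (h411 : prop411_selmer_isAlmostDivisible)
    (h422 : prop422_localCohomology_isAlmostDivisible) (h5A : sec5A_localH2_subsingleton_of_LOC1)
    (h41 : prop41_globalEulerPoincareCorank) (h42 : prop42_localEulerPoincareCorank)
    (h32 : prop32_cohomology_isCofinitelyGenerated)
    (h33 : BCGKPST2020.sec33_rubin_unrSelmer₂_finite_torsion)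
    (hT4 : weakLeopoldt_H2_subsingleton_above_cyclotomic_of_isOpen)
    (h141leTD : ∀ (W : WeierstrassCurve ℚ) [W.IsElliptic] [W.IsGloballyMinimal] (p : ℕ) [Fact p.Prime],
      2 < p → Good W p → Red W p → Anom W p →
      (∀ Φ : AddSubgroup (geomTorsion W (p : ℤ)), IsRationalLine W p Φ → ¬ LineUnramifiedAt W p Φ) →
      ∀ (K : Type) [Field K] [NumberField K], IsImaginaryQuadratic K →
        SatisfiesHeegnerHypothesis (W.conductorNorm ℤ) K → SatisfiesHeegnerHypothesis p K →
        (∀ Q : (W.baseChange K).toAffine.Point, p • Q = 0 → Q = 0) →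
      ∀ (ι : K →+* ℚ_[p]) (v vbar : HeightOneSpectrum (𝓞 K)),
        (∀ x : 𝓞 K, x ∈ v.asIdeal ↔ ‖ι (x : K)‖ < 1) →
        ((p : ℕ) : 𝓞 K) ∈ vbar.asIdeal → vbar ≠ v →
      ∀ (κ : ZpExtension K p), κ.IsAnticyclotomic →
      ∀ (γ : absoluteGaloisGroup K) [Fact (κ.IsTopGenerator γ)],
      ∀ (θsub θquot : FramedGaloisRep K (padicCoeffIntegers (∅ : Set (PadicAlgCl p))) 1),
        IsResidualPairOver (W.baseChange K) p θsub θquot →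
      ∀ (Sf : Finset (HeightOneSpectrum (𝓞 K))),
        (∀ w : HeightOneSpectrum (𝓞 K), w ∈ Sf ↔ ((W.conductorNorm ℤ : ℤ) : 𝓞 K) ∈ w.asIdeal) →
      ∀ (DSsub : DatumDualData κ γ (charModule ∅ θsub)
          (AcSelmer.bdpData (charModule ∅ θsub) p vbar) (↑Sf : Set (HeightOneSpectrum (𝓞 K))))
        (DSquot : DatumDualData κ γ (charModule ∅ θquot)
          (AcSelmer.bdpData (charModule ∅ θquot) p vbar) (↑Sf : Set (HeightOneSpectrum (𝓞 K)))),
      Module.Finite (IwasawaAlgebra p) (AcSelmer.XAc (W.baseChange K) p κ vbar (↑Sf : Set (HeightOneSpectrum (𝓞 K))) γ) →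
      Module.IsTorsion (IwasawaAlgebra p) (AcSelmer.XAc (W.baseChange K) p κ vbar (↑Sf : Set (HeightOneSpectrum (𝓞 K))) γ) →
      muInvariant p (AcSelmer.XAc (W.baseChange K) p κ vbar (↑Sf : Set (HeightOneSpectrum (𝓞 K))) γ) = 0 →
      (∀ D : DatumDualData κ γ (charModule ∅ θsub)
          (AcSelmer.bdpData (charModule ∅ θsub) p vbar) (↑Sf : Set (HeightOneSpectrum (𝓞 K))),
        Module.Finite (IwasawaAlgebra p) D.X ∧ Module.IsTorsion (IwasawaAlgebra p) D.X ∧ muInvariant p D.X = 0) →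
      (∀ D : DatumDualData κ γ (charModule ∅ θquot)
          (AcSelmer.bdpData (charModule ∅ θquot) p vbar) (↑Sf : Set (HeightOneSpectrum (𝓞 K))),
        Module.Finite (IwasawaAlgebra p) D.X ∧ Module.IsTorsion (IwasawaAlgebra p) D.X ∧ muInvariant p D.X = 0) →
      lambdaInvariant p DSsub.X + lambdaInvariant p DSquot.X ≤
        lambdaInvariant p (AcSelmer.XAc (W.baseChange K) p κ vbar (↑Sf : Set (HeightOneSpectrum (𝓞 K))) γ) +
          (if ∀ σ : absoluteGaloisGroup K, θquot σ = 1 then 1 else 0))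
    (h125 : prop125_residualPair_unrSelmer_imprimitive)
    (h142le : ∀ (W : WeierstrassCurve ℚ) [W.IsElliptic] [W.IsGloballyMinimal] (p : ℕ) [Fact p.Prime],
      2 < p → Good W p → Red W p → Anom W p →
      (∀ Φ : AddSubgroup (geomTorsion W (p : ℤ)), IsRationalLine W p Φ → ¬ LineUnramifiedAt W p Φ) →
      ∀ (K : Type) [Field K] [NumberField K], IsImaginaryQuadratic K →
        SatisfiesHeegnerHypothesis (W.conductorNorm ℤ) K → SatisfiesHeegnerHypothesis p K →
        (∀ Q : (W.baseChange K).toAffine.Point, p • Q = 0 → Q = 0) →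
      ∀ (ι : K →+* ℚ_[p]) (v vbar : HeightOneSpectrum (𝓞 K)),
        (∀ x : 𝓞 K, x ∈ v.asIdeal ↔ ‖ι (x : K)‖ < 1) →
        ((p : ℕ) : 𝓞 K) ∈ vbar.asIdeal → vbar ≠ v →
      ∀ (κ : ZpExtension K p), κ.IsAnticyclotomic →
      ∀ (γ : absoluteGaloisGroup K) [Fact (κ.IsTopGenerator γ)],
      ∀ (Sf : Finset (HeightOneSpectrum (𝓞 K))),
        (∀ w : HeightOneSpectrum (𝓞 K), w ∈ Sf ↔ ((W.conductorNorm ℤ : ℤ) : 𝓞 K) ∈ w.asIdeal) →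
      Module.Finite (IwasawaAlgebra p) (AcSelmer.XAc (W.baseChange K) p κ vbar ∅ γ) →
      Module.IsTorsion (IwasawaAlgebra p) (AcSelmer.XAc (W.baseChange K) p κ vbar ∅ γ) →
      zpCorank (↥(AcSelmer.selmerAc (W.baseChange K) p κ vbar (↑Sf : Set (HeightOneSpectrum (𝓞 K)))) ⧸
          (AcSelmer.selmerAc (W.baseChange K) p κ vbar (∅ : Set (HeightOneSpectrum (𝓞 K)))).addSubgroupOf
            (AcSelmer.selmerAc (W.baseChange K) p κ vbar (↑Sf : Set (HeightOneSpectrum (𝓞 K))))) p ≤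
        ∑ w ∈ Sf, curveLocalLambda κ (W.baseChange K) w)
    (hanQ : ∀ (W : WeierstrassCurve ℚ) [W.IsElliptic] [W.IsGloballyMinimal] (p : ℕ) [Fact p.Prime],
      2 < p → Good W p → Red W p → Anom W p →
      (∀ Φ : AddSubgroup (geomTorsion W (p : ℤ)), IsRationalLine W p Φ → ¬ LineUnramifiedAt W p Φ) →
      ∀ (K : Type) [Field K] [NumberField K], IsImaginaryQuadratic K →
        SatisfiesHeegnerHypothesis (W.conductorNorm ℤ) K → SatisfiesHeegnerHypothesis p K →
        Odd (NumberField.discr K) → NumberField.discr K ≠ -3 →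
        (∀ Q : (W.baseChange K).toAffine.Point, p • Q = 0 → Q = 0) →
      ∀ (ι : K →+* ℚ_[p]) (v vbar : HeightOneSpectrum (𝓞 K)),
        (∀ x : 𝓞 K, x ∈ v.asIdeal ↔ ‖ι (x : K)‖ < 1) →
        ((p : ℕ) : 𝓞 K) ∈ vbar.asIdeal → vbar ≠ v →
      ∀ (κ : ZpExtension K p), κ.IsAnticyclotomic →
      ∀ (γ : absoluteGaloisGroup K) [Fact (κ.IsTopGenerator γ)],
      ∀ (N : ℕ) [NeZero N] (Dt : ModularParametrizationData W N),
      ∀ (ι' : PadicAlgCl p ≃+* ℂ),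
        (∀ (w : InfinitePlace K) (k : 𝓞 K), k ∈ v.asIdeal ↔ ‖ι'.symm (w.embedding (k : K))‖ < 1) →
      ∀ (ΩK : ℂ) (Ωp : (unrIntegers p)ˣ) (L : UnrSeries p), ΩK ≠ 0 →
        IsBDPLFunction ι' v κ γ Dt.f ΩK ((Ωp : unrIntegers p) : ℂ_[p]) L →
      ∀ (Φ : AddSubgroup (geomTorsion W (p : ℤ))), IsRationalLine W p Φ →
      ∀ (θsub θquot : FramedGaloisRep ℚ (padicCoeffIntegers (∅ : Set (PadicAlgCl p))) 1),
        IsTeichmullerLiftOn (∅ : Set (PadicAlgCl p)) (Φ.map (geomTorsion W (p : ℤ)).subtype) θsub →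
        IsTeichmullerLiftOnQuot (∅ : Set (PadicAlgCl p)) (Φ.map (geomTorsion W (p : ℤ)).subtype)
          (geomTorsion W (p : ℤ)) θquot →
      ∀ (Sf : Finset (HeightOneSpectrum (𝓞 K))),
        (∀ w : HeightOneSpectrum (𝓞 K), w ∈ Sf ↔ ((W.conductorNorm ℤ : ℤ) : 𝓞 K) ∈ w.asIdeal) →
      ∀ (θK : HeckeCharacter K), IsHeckeCharOf ι' (θquot.restrictField K) θK →
      ∀ (S : Finset (HeightOneSpectrum (𝓞 K))),
        (∀ w : HeightOneSpectrum (𝓞 K), w ∈ S ↔ ¬ θK.IsUnramifiedAt w) →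
      ∀ (κ' : ZpExtension K p) (γ' : absoluteGaloisGroup K), ZpExtension.IsTopGeneratorPair κ κ' γ γ' →
      ∀ (Ω δ : ℂ) (Ωp' : (unrIntegers p)ˣ) (G : PowerSeries (PowerSeries (PadicComplexInt p)))
        (g : IwasawaAlgebra₂ p), Ω ≠ 0 →
        (δ ^ 2 = (NumberField.discr K : ℂ) ∨ δ ^ 2 = -(NumberField.discr K : ℂ)) →
        IsKatzMeasure₂ ι' v vbar S κ κ' γ⁻¹ γ'⁻¹ θK⁻¹ Ω δ ((Ωp' : unrIntegers p) : ℂ_[p]) G →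
        (∀ (J : ℤ_[p] →+* PadicComplexInt p),
          (∀ x : ℤ_[p], ((J x : PadicComplexInt p) : ℂ_[p]) = ((x : ℚ_[p]) : ℂ_[p])) →
          Associated (PowerSeries.map (PowerSeries.map J) g) G) →
        (g.map (PowerSeries.constantCoeff (R := ℤ_[p]))).map (IsLocalRing.residue ℤ_[p]) ≠ 0 →
      ∃ n : ℕ, FirstUnitCoeffAt L n ∧
        n + ∑ w ∈ Sf, curveLocalLambda κ (W.baseChange K) w =
          2 * ((g.map (PowerSeries.constantCoeff (R := ℤ_[p]))).map
                (IsLocalRing.residue ℤ_[p])).order.toNat +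
            ∑ w ∈ Sf, (charLocalLambda ∅ κ (θsub.restrictField K) w +
              charLocalLambda ∅ κ (θquot.restrictField K) w)) :
    Summit.BirchSwinnertonDyer.BirchSwinnertonDyer.Theses.EisensteinPrimes.GoodLatticeBDPValue := by
  unfold Summit.BirchSwinnertonDyer.BirchSwinnertonDyer.Theses.EisensteinPrimes.GoodLatticeBDPValue
  exact thm308_of_cgls_of_muLambda_of_three hC hdiv hval
    (fun W _ _ p _ ↦ goodLatticeMuLambdaOnTree_of_div_of_le_of_leTD_of_anQ h141leTD h125 h142le hanQ
      h331 (noPseudoNull_of_pub h411 h422 h5A h41 h42 h32 h33 hT4) hFE hO1 W p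
      (goodLatticeDivOnTree_of_cgls hdiv hC W p))

end Summit.BirchSwinnertonDyer.BirchSwinnertonDyer.Theorems.GoodLatticeBDPValueH1OfCGLS

end
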